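import Summits.Ventures.CertifiedArithmetic.LowPrec.PatternSubnormalRel

/-!
# Enum-seat rung statements: the per-band constants on the SUBNORMAL bands as proved algorithms

HONEST FRAMING (venture CertifiedArithmetic / cell `pub-lowprec`): certified error envelopes and
provably optimal rounding/accumulation schemes for low-precision formats under stated cost models;
every table by two implementations; no hardware or vendor claims.

`EnumRungsR1.lean` records, as named propositions with their proofs, that the whole-range and the
normal-band table constants of THEOREMS-R1 (Theorem E5, Remark E5′) are a proved algorithm for
every format triple. This file adds the SUBNORMAL bands of Remark E5′ (`PatternSubnormal.lean`,
`PatternSubnormalBands.lean`, `PatternSubnormalRel.lean`): for every `X, Y, R` and low band `γ`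
(`2^m q_R / 2^(γ+1) ≤ |t| < 2^m q_R / 2^γ`), the constants `envconstMulLowNE/TZ/Dir` (ulps =
quanta; times `q_R` the absolute column) and `envconstMulLowRelNE/TZ/Dir` (relative) bound the
error of every product of data in the band for the rounding of their column, and each is attained
in the band as soon as one product of data lies there (`R1_LowBandConstantsMul`); sums alike
(`R1_LowBandConstantsAdd`). FP6/FP4 instances by `decide`: `PatternSubnormalBands{Mul,Add}FP6FP4`,
`PatternSubnormalRel{Mul,Add}FP6FP4`.
-/

namespace Summit.Ventures.CertifiedArithmetic

open Literature.ComputerArithmetic.FloatingPoint Literature.ComputerArithmetic.FloatingPoint.Format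
  Literature.ComputerArithmetic.FloatingPoint.MiniFloat

/-- R1 (THE SUBNORMAL-BAND TABLES ARE A PROVED ALGORITHM; THEOREMS-R1-BANDS Remark E5′, subnormal
bands, all three columns — every `X, Y, R, γ`, products): for each rounding of the table paired
with its ulp constant `c` and relative constant `c'` of low band `γ`, every product of data in the
band has error `≤ c · q_R` and `≤ c' · |a·b|`, and both are attained in the band as soon as one
product of data lies there. -/
def R1_LowBandConstantsMul (X Y R : Format) (γ : ℕ) : Prop :=
  ∀ p : (ℚ → MiniFloat R) × ℚ × ℚ,
    p ∈ [(roundNE R, envconstMulLowNE X Y R γ, envconstMulLowRelNE X Y R γ),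
      (roundTowardZero R, envconstMulLowTZ X Y R γ, envconstMulLowRelTZ X Y R γ),
      (roundDown R, envconstMulLowDir X Y R γ, envconstMulLowRelDir X Y R γ),
      (roundUp R, envconstMulLowDir X Y R γ, envconstMulLowRelDir X Y R γ)] →
    (∀ (a : MiniFloat X) (b : MiniFloat Y),
      2 ^ R.manBits * R.quantum ≤ |a.toRat * b.toRat| * 2 ^ (γ + 1) →
      |a.toRat * b.toRat| * 2 ^ (γ + 1) < 2 ^ (R.manBits + 1) * R.quantum →
      |a.toRat * b.toRat| ≤ R.maxRat →
        |(p.1 (a.toRat * b.toRat)).toRat - a.toRat * b.toRat| ≤ p.2.1 * R.quantum ∧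
        |(p.1 (a.toRat * b.toRat)).toRat - a.toRat * b.toRat| ≤ p.2.2 * |a.toRat * b.toRat|) ∧
    ((∃ (a : MiniFloat X) (b : MiniFloat Y),
        2 ^ R.manBits * R.quantum ≤ |a.toRat * b.toRat| * 2 ^ (γ + 1) ∧
        |a.toRat * b.toRat| * 2 ^ (γ + 1) < 2 ^ (R.manBits + 1) * R.quantum ∧
        |a.toRat * b.toRat| ≤ R.maxRat) →
      (∃ (a : MiniFloat X) (b : MiniFloat Y),
        2 ^ R.manBits * R.quantum ≤ |a.toRat * b.toRat| * 2 ^ (γ + 1) ∧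
        |a.toRat * b.toRat| * 2 ^ (γ + 1) < 2 ^ (R.manBits + 1) * R.quantum ∧
        |a.toRat * b.toRat| ≤ R.maxRat ∧
        |(p.1 (a.toRat * b.toRat)).toRat - a.toRat * b.toRat| = p.2.1 * R.quantum) ∧
      (∃ (a : MiniFloat X) (b : MiniFloat Y),
        2 ^ R.manBits * R.quantum ≤ |a.toRat * b.toRat| * 2 ^ (γ + 1) ∧
        |a.toRat * b.toRat| * 2 ^ (γ + 1) < 2 ^ (R.manBits + 1) * R.quantum ∧
        |a.toRat * b.toRat| ≤ R.maxRat ∧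
        |(p.1 (a.toRat * b.toRat)).toRat - a.toRat * b.toRat| = p.2.2 * |a.toRat * b.toRat|))

/-- R1 subnormal-band product tables: PROVED for every format triple and low band
(`PatternSubnormalBands.lean`: `MiniFloat.low_le`, `low_attained`; `PatternSubnormalRel.lean`:
`lowRel_le`, `lowRel_attained`, at the product model `mulModel`). -/
theorem R1_LowBandConstantsMul_holds (X Y R : Format) (γ : ℕ) :
    R1_LowBandConstantsMul X Y R γ := by
  intro p hp
  simp only [List.mem_cons, List.not_mem_nil, or_false] at hp
  rcases hp with rfl | rfl | rfl | rfl
  · exact ⟨fun a b h1 h2 h3 => ⟨low_le (lowBridgeNE R) (mulModel X Y R) γ a b h1 h2 h3,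
        lowRel_le (lowBridgeNE R) (mulModel X Y R) γ a b h1 h2 h3⟩,
      fun ⟨a, b, h1, h2, h3⟩ =>
        ⟨low_attained (lowBridgeNE R) (mulModel X Y R) γ
            (lowErrsOf_ne_nil_of_band _ (mulModel X Y R) γ a b h1 h2 h3),
          lowRel_attained (lowBridgeNE R) (mulModel X Y R) γ
            (lowErrsOf_ne_nil_of_band _ (mulModel X Y R) γ a b h1 h2 h3)⟩⟩
  · exact ⟨fun a b h1 h2 h3 => ⟨low_le (lowBridgeTZ R) (mulModel X Y R) γ a b h1 h2 h3,
        lowRel_le (lowBridgeTZ R) (mulModel X Y R) γ a b h1 h2 h3⟩,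
      fun ⟨a, b, h1, h2, h3⟩ =>
        ⟨low_attained (lowBridgeTZ R) (mulModel X Y R) γ
            (lowErrsOf_ne_nil_of_band _ (mulModel X Y R) γ a b h1 h2 h3),
          lowRel_attained (lowBridgeTZ R) (mulModel X Y R) γ
            (lowErrsOf_ne_nil_of_band _ (mulModel X Y R) γ a b h1 h2 h3)⟩⟩
  · exact ⟨fun a b h1 h2 h3 => ⟨low_le (lowBridgeRD R) (mulModel X Y R) γ a b h1 h2 h3,
        lowRel_le (lowBridgeRD R) (mulModel X Y R) γ a b h1 h2 h3⟩,
      fun ⟨a, b, h1, h2, h3⟩ =>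
        ⟨low_attained (lowBridgeRD R) (mulModel X Y R) γ
            (lowErrsOf_ne_nil_of_band _ (mulModel X Y R) γ a b h1 h2 h3),
          lowRel_attained (lowBridgeRD R) (mulModel X Y R) γ
            (lowErrsOf_ne_nil_of_band _ (mulModel X Y R) γ a b h1 h2 h3)⟩⟩
  · exact ⟨fun a b h1 h2 h3 => ⟨low_le (lowBridgeRU R) (mulModel X Y R) γ a b h1 h2 h3,
        lowRel_le (lowBridgeRU R) (mulModel X Y R) γ a b h1 h2 h3⟩,
      fun ⟨a, b, h1, h2, h3⟩ =>
        ⟨low_attained (lowBridgeRU R) (mulModel X Y R) γ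
            (lowErrsOf_ne_nil_of_band _ (mulModel X Y R) γ a b h1 h2 h3),
          lowRel_attained (lowBridgeRU R) (mulModel X Y R) γ
            (lowErrsOf_ne_nil_of_band _ (mulModel X Y R) γ a b h1 h2 h3)⟩⟩

/-- R1 (subnormal-band tables, sums; every `X, Y, R, γ`): as `R1_LowBandConstantsMul` for the sums
of data, with the constants `envconstAddLowNE/TZ/Dir` and `envconstAddLowRelNE/TZ/Dir`. -/
def R1_LowBandConstantsAdd (X Y R : Format) (γ : ℕ) : Prop :=
  ∀ p : (ℚ → MiniFloat R) × ℚ × ℚ,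
    p ∈ [(roundNE R, envconstAddLowNE X Y R γ, envconstAddLowRelNE X Y R γ),
      (roundTowardZero R, envconstAddLowTZ X Y R γ, envconstAddLowRelTZ X Y R γ),
      (roundDown R, envconstAddLowDir X Y R γ, envconstAddLowRelDir X Y R γ),
      (roundUp R, envconstAddLowDir X Y R γ, envconstAddLowRelDir X Y R γ)] →
    (∀ (a : MiniFloat X) (b : MiniFloat Y),
      2 ^ R.manBits * R.quantum ≤ |a.toRat + b.toRat| * 2 ^ (γ + 1) →
      |a.toRat + b.toRat| * 2 ^ (γ + 1) < 2 ^ (R.manBits + 1) * R.quantum →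
      |a.toRat + b.toRat| ≤ R.maxRat →
        |(p.1 (a.toRat + b.toRat)).toRat - (a.toRat + b.toRat)| ≤ p.2.1 * R.quantum ∧
        |(p.1 (a.toRat + b.toRat)).toRat - (a.toRat + b.toRat)| ≤ p.2.2 * |a.toRat + b.toRat|) ∧
    ((∃ (a : MiniFloat X) (b : MiniFloat Y),
        2 ^ R.manBits * R.quantum ≤ |a.toRat + b.toRat| * 2 ^ (γ + 1) ∧
        |a.toRat + b.toRat| * 2 ^ (γ + 1) < 2 ^ (R.manBits + 1) * R.quantum ∧
        |a.toRat + b.toRat| ≤ R.maxRat) →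
      (∃ (a : MiniFloat X) (b : MiniFloat Y),
        2 ^ R.manBits * R.quantum ≤ |a.toRat + b.toRat| * 2 ^ (γ + 1) ∧
        |a.toRat + b.toRat| * 2 ^ (γ + 1) < 2 ^ (R.manBits + 1) * R.quantum ∧
        |a.toRat + b.toRat| ≤ R.maxRat ∧
        |(p.1 (a.toRat + b.toRat)).toRat - (a.toRat + b.toRat)| = p.2.1 * R.quantum) ∧
      (∃ (a : MiniFloat X) (b : MiniFloat Y),
        2 ^ R.manBits * R.quantum ≤ |a.toRat + b.toRat| * 2 ^ (γ + 1) ∧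
        |a.toRat + b.toRat| * 2 ^ (γ + 1) < 2 ^ (R.manBits + 1) * R.quantum ∧
        |a.toRat + b.toRat| ≤ R.maxRat ∧
        |(p.1 (a.toRat + b.toRat)).toRat - (a.toRat + b.toRat)| = p.2.2 * |a.toRat + b.toRat|))

/-- R1 subnormal-band sum tables: PROVED for every format triple and low band (the same generic
theorems at the sum model `addModel`). -/
theorem R1_LowBandConstantsAdd_holds (X Y R : Format) (γ : ℕ) :
    R1_LowBandConstantsAdd X Y R γ := by
  intro p hp
  simp only [List.mem_cons, List.not_mem_nil, or_false] at hp
  rcases hp with rfl | rfl | rfl | rfl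
  · exact ⟨fun a b h1 h2 h3 => ⟨low_le (lowBridgeNE R) (addModel X Y R) γ a b h1 h2 h3,
        lowRel_le (lowBridgeNE R) (addModel X Y R) γ a b h1 h2 h3⟩,
      fun ⟨a, b, h1, h2, h3⟩ =>
        ⟨low_attained (lowBridgeNE R) (addModel X Y R) γ
            (lowErrsOf_ne_nil_of_band _ (addModel X Y R) γ a b h1 h2 h3),
          lowRel_attained (lowBridgeNE R) (addModel X Y R) γ
            (lowErrsOf_ne_nil_of_band _ (addModel X Y R) γ a b h1 h2 h3)⟩⟩
  · exact ⟨fun a b h1 h2 h3 => ⟨low_le (lowBridgeTZ R) (addModel X Y R) γ a b h1 h2 h3,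
        lowRel_le (lowBridgeTZ R) (addModel X Y R) γ a b h1 h2 h3⟩,
      fun ⟨a, b, h1, h2, h3⟩ =>
        ⟨low_attained (lowBridgeTZ R) (addModel X Y R) γ
            (lowErrsOf_ne_nil_of_band _ (addModel X Y R) γ a b h1 h2 h3),
          lowRel_attained (lowBridgeTZ R) (addModel X Y R) γ
            (lowErrsOf_ne_nil_of_band _ (addModel X Y R) γ a b h1 h2 h3)⟩⟩
  · exact ⟨fun a b h1 h2 h3 => ⟨low_le (lowBridgeRD R) (addModel X Y R) γ a b h1 h2 h3,
        lowRel_le (lowBridgeRD R) (addModel X Y R) γ a b h1 h2 h3⟩,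
      fun ⟨a, b, h1, h2, h3⟩ =>
        ⟨low_attained (lowBridgeRD R) (addModel X Y R) γ
            (lowErrsOf_ne_nil_of_band _ (addModel X Y R) γ a b h1 h2 h3),
          lowRel_attained (lowBridgeRD R) (addModel X Y R) γ
            (lowErrsOf_ne_nil_of_band _ (addModel X Y R) γ a b h1 h2 h3)⟩⟩
  · exact ⟨fun a b h1 h2 h3 => ⟨low_le (lowBridgeRU R) (addModel X Y R) γ a b h1 h2 h3,
        lowRel_le (lowBridgeRU R) (addModel X Y R) γ a b h1 h2 h3⟩,
      fun ⟨a, b, h1, h2, h3⟩ =>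
        ⟨low_attained (lowBridgeRU R) (addModel X Y R) γ
            (lowErrsOf_ne_nil_of_band _ (addModel X Y R) γ a b h1 h2 h3),
          lowRel_attained (lowBridgeRU R) (addModel X Y R) γ
            (lowErrsOf_ne_nil_of_band _ (addModel X Y R) γ a b h1 h2 h3)⟩⟩

end Summit.Ventures.CertifiedArithmetic
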